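import Summits.AtomisticToContinuum.Crystallization.Theorems.DisclinationRationBarlowLiouvilleStubCellsToPatches2

/-!
# `BarlowLiouville` (route `DisclinationRation`), stubs `stub_cellsToPatches` and
# `stub_rigidityCompactness`: cells to patches, unconditionally (contradiction + compactness)

Final part (3 of 3) for item stmt-AtomisticToContinuum-15801 (crux
`Summit.AtomisticToContinuum.Crystallization.Theses.DisclinationRation.BarlowLiouville`, line `Sketch`,
rev 4 of the lead skeleton `DisclinationRationBarlowLiouville`); parts 1–2 are
`…StubCellsToPatches1/2`. With the line's inlined vocabulary (`CELL ς X y`: the `2`-cell `X − y` is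
two-way `ς`-matched on the OPEN ball `‖·‖ < 2` with a rigid image of a relaxed layered set;
`PATCH R η X y`: the same on `‖·‖ ≤ R` with tolerance `η`):

* `stub_cellsToPatches` — CELLS TO PATCHES, UNCONDITIONALLY: for every `δ > 0`, `R`, `η > 0` there are
  `ς > 0` and `r ≥ 0` such that in every `δ`-separated `X`, `ς`-good cells at all points of `B̄_r(y) ∩ X`
  force an `η`-good `R`-patch at `y`. This is the statement `cellsToPatches` of the lead skeleton, which
  there was the composition of the two registered stubs `stub_exactLocalRigidity` (EXACT local rigidity)
  and `stub_rigidityCompactness` (EXACT ⟹ quantitative); here it is proved outright, the exact input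
  being the landed EXACT LOCAL-TO-GLOBAL RIGIDITY of box templates of the sibling line
  `prestress-split-korn` (`PrestressSplitKorn.exactLayeredRigidity_holds`, through `rc_glob` of part 2).
* `stub_rigidityCompactness` — the registered stub (EXACT ⟹ quantitative), now a triviality.

Proof of `stub_cellsToPatches` (`rc_abstract`, for abstract predicates `cell`, `patch`; pattern of
`PrestressSplitKorn.layeredGluing_of_exactRigidity`): if not, there are `δ`-separated `X_k ∋ y_k` whose
cells on `B̄_k(y_k)` are `1/(k+1)`-good but whose `R`-patch at `y_k` is `η`-bad. Translate `y_k ↦ 0`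
(`rc_cell_translate`) and extract a local limit `Y ∋ 0` in the local matching topology
(`exists_subseq_forall_eventually_ballMatch`, `rc_zero_mem`). Every point of `Y` has `ς`-good cells for
every `ς > 0` (`rc_cell_limit`), so `Y` has a `min(η/2,1)`-good `(R+1)`-patch at `0` (`rc_glob`), which
transports back along a fine local match to an `η`-good `R`-patch of a far-out `X_k − y_k` at `0`
(`rc_patch_transfer`), i.e. of `X_k` at `y_k` (`rc_patch_translate`) — contradiction.

No definitions. [folklore] throughout.
-/

noncomputable section

namespace Summit.AtomisticToContinuum.Crystallization.Theorems.DisclinationRationBarlowLiouville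

open Filter Topology Metric
open Literature.MathematicalPhysics.StatisticalMechanics Literature.Geometry.DiscreteGeometry
-- `E3 = EuclideanSpace ℝ (Fin 3)` as the (reducible) library abbreviation (no notation declared here).
open Summit.AtomisticToContinuum.Crystallization.Theorems.ChargedEnergyGapNegative (E3)

/-! ## The contradiction argument, for abstract cell and patch predicates -/

/-- THE COMPACTNESS ARGUMENT, ABSTRACTLY. Let `cell ς X y` and `patch R η X y` be predicates such that
cells and patches are translation-covariant (`htc`, `htp`), cells of vanishing tolerance on growing balls
pass to local limits of `δ`-separated sets as cells of every tolerance (`hlim`), good patches transport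
back along fine local matches (`htr`), and a `δ`-separated set containing `0` all of whose points have
cells of every tolerance has good patches of every size at `0` (`hglob`). Then for every `(δ, R, η)` some
`ς > 0` and `r ≥ 0` make `ς`-good cells on `B̄_r(y)` force an `η`-good `R`-patch at `y`: otherwise
translate the counterexamples `X_k ∋ y_k` (tolerance `1/(k+1)`, radius `k`) to `y_k ↦ 0`, extract a local
limit `Y ∋ 0` (`exists_subseq_forall_eventually_ballMatch`), all of whose points have cells of every
tolerance, take its `min(η/2,1)`-good `(R+1)`-patch at `0` and transport it back to a far-out `X_k`.
[folklore] -/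
theorem rc_abstract (cell : ℝ → Set E3 → E3 → Prop) (patch : ℝ → ℝ → Set E3 → E3 → Prop)
    (htc : ∀ (ς : ℝ) (X : Set E3) (y y' : E3), cell ς X y' →
      cell ς ((fun q => q - y) '' X) (y' - y))
    (htp : ∀ (R η : ℝ) (X : Set E3) (y : E3), patch R η ((fun q => q - y) '' X) 0 → patch R η X y)
    (hlim : ∀ δ : ℝ, 0 < δ → ∀ (Xs : ℕ → Set E3) (Y : Set E3) (ςs : ℕ → ℝ) (r : ℝ),
      (∀ p ∈ Y, ∀ q ∈ Y, p ≠ q → δ ≤ dist p q) →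
      (∀ R ε : ℝ, 0 < ε → ∀ᶠ k in atTop, BallMatch ε R 0 (Xs k) Y) →
      Tendsto ςs atTop (𝓝 0) →
      (∀ᶠ k : ℕ in atTop, ∀ w' ∈ Xs k, ‖w'‖ ≤ r + 1 → cell (ςs k) (Xs k) w') →
      ∀ w ∈ Y, dist w 0 ≤ r → ∀ ς : ℝ, 0 < ς → cell ς Y w)
    (htr : ∀ R η : ℝ, 0 < η → ∀ X Y : Set E3, BallMatch (min (η / 2) 1) (R + 2) 0 X Y →
      patch (R + 1) (min (η / 2) 1) Y 0 → patch R η X 0)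
    (hglob : ∀ δ : ℝ, 0 < δ → ∀ Y : Set E3, (∀ p ∈ Y, ∀ q ∈ Y, p ≠ q → δ ≤ dist p q) →
      (0 : E3) ∈ Y → (∀ w ∈ Y, ∀ ς : ℝ, 0 < ς → cell ς Y w) → ∀ R η : ℝ, 0 < η → patch R η Y 0) :
    ∀ δ : ℝ, 0 < δ → ∀ R η : ℝ, 0 < η → ∃ ς : ℝ, 0 < ς ∧ ∃ r : ℝ, 0 ≤ r ∧ ∀ X : Set E3,
      (∀ y ∈ X, ∀ z ∈ X, y ≠ z → δ ≤ dist y z) → ∀ y ∈ X,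
      (∀ y' ∈ X, dist y' y ≤ r → cell ς X y') → patch R η X y := by
  intro δ hδ R η hη
  by_contra hcon
  push Not at hcon
  choose X hXsep y hy hcell hbad using
    fun k : ℕ => hcon (1 / ((k : ℝ) + 1)) (by positivity) (k : ℝ) (Nat.cast_nonneg k)
  -- the translated sets `X k - y k ∋ 0` are `δ`-separated: extract a local limit `Y ∋ 0`
  have hXs_sep : ∀ k : ℕ, ∀ p ∈ (fun q => q - y k) '' X k, ∀ q ∈ (fun q => q - y k) '' X k,
      p ≠ q → δ ≤ dist p q := by
    intro k p hp q hq hne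
    obtain ⟨p', hp', rfl⟩ := (Set.mem_image _ _ _).1 hp
    obtain ⟨q', hq', rfl⟩ := (Set.mem_image _ _ _).1 hq
    rw [dist_sub_right]
    exact hXsep k p' hp' q' hq' fun hpq => hne (by rw [hpq])
  obtain ⟨φ, Y, hφ, hYsep, hBM⟩ := exists_subseq_forall_eventually_ballMatch hδ _ hXs_sep
  have hY0 : (0 : E3) ∈ Y :=
    rc_zero_mem (Xs := fun k => (fun q => q - y (φ k)) '' X (φ k)) hδ hYsep
      (fun k => ⟨y (φ k), hy (φ k), sub_self _⟩) hBM
  -- every point of `Y` has cells of every tolerance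
  have hT : Tendsto (fun k : ℕ => 1 / (((φ k : ℕ) : ℝ) + 1)) atTop (𝓝 0) :=
    (tendsto_one_div_add_atTop_nhds_zero_nat (𝕜 := ℝ)).comp hφ.tendsto_atTop
  have hYcell : ∀ w ∈ Y, ∀ ς : ℝ, 0 < ς → cell ς Y w := by
    intro w hw
    have hev : ∀ᶠ k : ℕ in atTop, ∀ w' ∈ (fun q => q - y (φ k)) '' X (φ k), ‖w'‖ ≤ ‖w‖ + 1 →
        cell (1 / (((φ k : ℕ) : ℝ) + 1)) ((fun q => q - y (φ k)) '' X (φ k)) w' := by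
      filter_upwards [tendsto_natCast_atTop_atTop.eventually_ge_atTop (‖w‖ + 1)] with k hk
      intro w' hw' hwn
      obtain ⟨q, hq, rfl⟩ := (Set.mem_image _ _ _).1 hw'
      refine htc _ _ _ _ (hcell (φ k) q hq ?_)
      have hkφ : ((k : ℕ) : ℝ) ≤ ((φ k : ℕ) : ℝ) := by exact_mod_cast hφ.le_apply
      rw [dist_eq_norm]
      linarith
    exact hlim δ hδ (fun k => (fun q => q - y (φ k)) '' X (φ k)) Y
      (fun k : ℕ => 1 / (((φ k : ℕ) : ℝ) + 1)) ‖w‖ hYsep hBM hT hev w hw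
      (by rw [dist_zero_right])
  -- a good `(R + 1)`-patch of `Y` at `0`, transported back to a far-out `X (φ k) - y (φ k)`
  have hYpatch := hglob δ hδ Y hYsep hY0 hYcell (R + 1) (min (η / 2) 1) (by positivity)
  obtain ⟨k, hk⟩ := (hBM (R + 2) (min (η / 2) 1) (by positivity)).exists
  exact hbad (φ k) (htp R η (X (φ k)) (y (φ k)) (htr R η hη _ Y hk hYpatch))

/-! ## The stubs -/

/-- CELLS TO PATCHES (the statement `cellsToPatches` of the lead skeleton of the line `Sketch` of
`BarlowLiouville`, proved outright): for every `δ > 0`, radius `R` and tolerance `η > 0` there are a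
tolerance `ς > 0` and a radius `r ≥ 0` such that in every `δ`-separated `X ⊆ ℝ³`, if every point `y'` of
`X` within `r` of `y` has its `2`-cell `ς`-good (two-way `ς`-matched on the open ball `‖·‖ < 2` with a
rigid image of a relaxed layered set), then the `R`-ball of `X` about `y` is `η`-good (two-way `η`-matched
on `‖·‖ ≤ R` with such a set) — contradiction + compactness of `δ`-separated sets in the local matching
topology + the exact local-to-global rigidity of box templates (`rc_abstract` fed with
`rc_cell_translate`, `rc_patch_translate`, `rc_cell_limit`, `rc_patch_transfer`, `rc_glob`). [folklore] -/
theorem stub_cellsToPatches :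
    ∀ δ : ℝ, 0 < δ → ∀ R η : ℝ, 0 < η → ∃ ς : ℝ, 0 < ς ∧ ∃ r : ℝ, 0 ≤ r ∧ ∀ X : Set E3, (∀ y ∈ X, ∀ z ∈ X, y ≠ z → δ ≤ dist y z) →
      ∀ y ∈ X, (∀ y' ∈ X, dist y' y ≤ r → (∃ a : ℝ, 47 / 50 ≤ a ∧ a ≤ 1 ∧
          ∃ (A : E3 →ₗᵢ[ℝ] E3) (s : ℤ → ℤ) (z : ℤ → ℝ), IsHaggSeq s ∧
            (∀ m : ℤ, 39 / 50 * a ≤ z (m + 1) - z m ∧ z (m + 1) - z m ≤ 17 / 20 * a) ∧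
            let S : Set E3 := {p | ∃ m i j : ℤ, p = A (((i : ℝ) • triangularVec₁ a) +
              ((j : ℝ) • triangularVec₂ a) + ((haggLabel s m : ℝ) • barlowOffset a) +
              (z m • layerNormal 1))}
            (∀ p ∈ S, ‖p‖ < 2 → ∃ q ∈ X, dist (q - y') p ≤ ς) ∧
            (∀ q ∈ X, ‖q - y'‖ < 2 → ∃ p ∈ S, dist (q - y') p ≤ ς))) →
      (∃ a : ℝ, 47 / 50 ≤ a ∧ a ≤ 1 ∧
          ∃ (A : E3 →ₗᵢ[ℝ] E3) (s : ℤ → ℤ) (z : ℤ → ℝ), IsHaggSeq s ∧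
            (∀ m : ℤ, 39 / 50 * a ≤ z (m + 1) - z m ∧ z (m + 1) - z m ≤ 17 / 20 * a) ∧
            let S : Set E3 := {p | ∃ m i j : ℤ, p = A (((i : ℝ) • triangularVec₁ a) +
              ((j : ℝ) • triangularVec₂ a) + ((haggLabel s m : ℝ) • barlowOffset a) +
              (z m • layerNormal 1))}
            (∀ p ∈ S, ‖p‖ ≤ R → ∃ q ∈ X, dist (q - y) p ≤ η) ∧
            (∀ q ∈ X, ‖q - y‖ ≤ R → ∃ p ∈ S, dist (q - y) p ≤ η)) :=
  rc_abstract
    (fun ς X y' => ∃ a : ℝ, 47 / 50 ≤ a ∧ a ≤ 1 ∧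
      ∃ (A : E3 →ₗᵢ[ℝ] E3) (s : ℤ → ℤ) (z : ℤ → ℝ), IsHaggSeq s ∧
        (∀ m : ℤ, 39 / 50 * a ≤ z (m + 1) - z m ∧ z (m + 1) - z m ≤ 17 / 20 * a) ∧
        let S : Set E3 := {p | ∃ m i j : ℤ, p = A (((i : ℝ) • triangularVec₁ a) +
          ((j : ℝ) • triangularVec₂ a) + ((haggLabel s m : ℝ) • barlowOffset a) +
          (z m • layerNormal 1))}
        (∀ p ∈ S, ‖p‖ < 2 → ∃ q ∈ X, dist (q - y') p ≤ ς) ∧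
        (∀ q ∈ X, ‖q - y'‖ < 2 → ∃ p ∈ S, dist (q - y') p ≤ ς))
    (fun R η X y => ∃ a : ℝ, 47 / 50 ≤ a ∧ a ≤ 1 ∧
      ∃ (A : E3 →ₗᵢ[ℝ] E3) (s : ℤ → ℤ) (z : ℤ → ℝ), IsHaggSeq s ∧
        (∀ m : ℤ, 39 / 50 * a ≤ z (m + 1) - z m ∧ z (m + 1) - z m ≤ 17 / 20 * a) ∧
        let S : Set E3 := {p | ∃ m i j : ℤ, p = A (((i : ℝ) • triangularVec₁ a) +
          ((j : ℝ) • triangularVec₂ a) + ((haggLabel s m : ℝ) • barlowOffset a) +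
          (z m • layerNormal 1))}
        (∀ p ∈ S, ‖p‖ ≤ R → ∃ q ∈ X, dist (q - y) p ≤ η) ∧
        (∀ q ∈ X, ‖q - y‖ ≤ R → ∃ p ∈ S, dist (q - y) p ≤ η))
    rc_cell_translate rc_patch_translate rc_cell_limit rc_patch_transfer rc_glob

/-- STUB G₂ of the line `Sketch` of `BarlowLiouville` (M, compactness) — FROM EXACT TO QUANTITATIVE LOCAL
RIGIDITY, the registered signature: if exact `2`-clusters on a large ball force an exact `R`-patch (the
statement of the companion stub `stub_exactLocalRigidity`, taken as hypothesis), then for every `(R, η)`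
some tolerance `ς > 0` and radius `r` make `ς`-good `2`-clusters on `B̄_r(y)` force an `η`-good `R`-patch
at `y`, in every `δ`-separated `X`. The conclusion holds outright (`stub_cellsToPatches`), so the
hypothesis is not used. [folklore] -/
theorem stub_rigidityCompactness :
    (∀ δ : ℝ, 0 < δ → ∀ R : ℝ, ∃ r : ℝ, 0 ≤ r ∧ ∀ X : Set E3, (∀ y ∈ X, ∀ z ∈ X, y ≠ z → δ ≤ dist y z) →
      ∀ y ∈ X, (∀ y' ∈ X, dist y' y ≤ r → ∀ ς : ℝ, 0 < ς → (∃ a : ℝ, 47 / 50 ≤ a ∧ a ≤ 1 ∧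
          ∃ (A : E3 →ₗᵢ[ℝ] E3) (s : ℤ → ℤ) (z : ℤ → ℝ), IsHaggSeq s ∧
            (∀ m : ℤ, 39 / 50 * a ≤ z (m + 1) - z m ∧ z (m + 1) - z m ≤ 17 / 20 * a) ∧
            let S : Set E3 := {p | ∃ m i j : ℤ, p = A (((i : ℝ) • triangularVec₁ a) +
              ((j : ℝ) • triangularVec₂ a) + ((haggLabel s m : ℝ) • barlowOffset a) +
              (z m • layerNormal 1))}
            (∀ p ∈ S, ‖p‖ < 2 → ∃ q ∈ X, dist (q - y') p ≤ ς) ∧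
            (∀ q ∈ X, ‖q - y'‖ < 2 → ∃ p ∈ S, dist (q - y') p ≤ ς))) →
      ∀ η : ℝ, 0 < η → (∃ a : ℝ, 47 / 50 ≤ a ∧ a ≤ 1 ∧
          ∃ (A : E3 →ₗᵢ[ℝ] E3) (s : ℤ → ℤ) (z : ℤ → ℝ), IsHaggSeq s ∧
            (∀ m : ℤ, 39 / 50 * a ≤ z (m + 1) - z m ∧ z (m + 1) - z m ≤ 17 / 20 * a) ∧
            let S : Set E3 := {p | ∃ m i j : ℤ, p = A (((i : ℝ) • triangularVec₁ a) +
              ((j : ℝ) • triangularVec₂ a) + ((haggLabel s m : ℝ) • barlowOffset a) +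
              (z m • layerNormal 1))}
            (∀ p ∈ S, ‖p‖ ≤ R → ∃ q ∈ X, dist (q - y) p ≤ η) ∧
            (∀ q ∈ X, ‖q - y‖ ≤ R → ∃ p ∈ S, dist (q - y) p ≤ η))) →
    ∀ δ : ℝ, 0 < δ → ∀ R η : ℝ, 0 < η → ∃ ς : ℝ, 0 < ς ∧ ∃ r : ℝ, 0 ≤ r ∧ ∀ X : Set E3, (∀ y ∈ X, ∀ z ∈ X, y ≠ z → δ ≤ dist y z) →
      ∀ y ∈ X, (∀ y' ∈ X, dist y' y ≤ r → (∃ a : ℝ, 47 / 50 ≤ a ∧ a ≤ 1 ∧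
          ∃ (A : E3 →ₗᵢ[ℝ] E3) (s : ℤ → ℤ) (z : ℤ → ℝ), IsHaggSeq s ∧
            (∀ m : ℤ, 39 / 50 * a ≤ z (m + 1) - z m ∧ z (m + 1) - z m ≤ 17 / 20 * a) ∧
            let S : Set E3 := {p | ∃ m i j : ℤ, p = A (((i : ℝ) • triangularVec₁ a) +
              ((j : ℝ) • triangularVec₂ a) + ((haggLabel s m : ℝ) • barlowOffset a) +
              (z m • layerNormal 1))}
            (∀ p ∈ S, ‖p‖ < 2 → ∃ q ∈ X, dist (q - y') p ≤ ς) ∧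
            (∀ q ∈ X, ‖q - y'‖ < 2 → ∃ p ∈ S, dist (q - y') p ≤ ς))) →
      (∃ a : ℝ, 47 / 50 ≤ a ∧ a ≤ 1 ∧
          ∃ (A : E3 →ₗᵢ[ℝ] E3) (s : ℤ → ℤ) (z : ℤ → ℝ), IsHaggSeq s ∧
            (∀ m : ℤ, 39 / 50 * a ≤ z (m + 1) - z m ∧ z (m + 1) - z m ≤ 17 / 20 * a) ∧
            let S : Set E3 := {p | ∃ m i j : ℤ, p = A (((i : ℝ) • triangularVec₁ a) +
              ((j : ℝ) • triangularVec₂ a) + ((haggLabel s m : ℝ) • barlowOffset a) +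
              (z m • layerNormal 1))}
            (∀ p ∈ S, ‖p‖ ≤ R → ∃ q ∈ X, dist (q - y) p ≤ η) ∧
            (∀ q ∈ X, ‖q - y‖ ≤ R → ∃ p ∈ S, dist (q - y) p ≤ η)) :=
  fun _ => stub_cellsToPatches

end Summit.AtomisticToContinuum.Crystallization.Theorems.DisclinationRationBarlowLiouville

end
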